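import Summits.CriticalPhenomena.SAWScalingLimit.Theorems.SAWRestrictionRigidityLimitExistsObservablewiseTight
import Summits.CriticalPhenomena.SAWScalingLimit.Theorems.SAWConePseudogroupLatticeSimilarityOfLimitTransport
import Literature.Probability.RandomPlanarGeometry.LoopSpaceMaps
import HarnessLib

/-!
# `LimitExists` (crux stmt-CriticalPhenomena-1371) — GEOMETRIC MESHES and MESH CONTINUITY

Route `SAWRestrictionRigidity` of `CriticalPhenomena/SAWScalingLimit`; line `registered`
(`Cruxes/LimitExists/Lines/birth.lean`), lead c6.

The crux is the convergence of every critical expectation `u(δ) = E_δ[f(γ)]` along the FULL mesh filter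
`δ → 0⁺` (`limitExists_iff_forall_tendsto_integral`).  A renormalisation-shaped argument compares the critical
SAW of `Ω_δ` with that of its refinement `Ω_{δ/2}` (`δℤ² ⊆ (δ/2)ℤ²`) and can at best control `u` along the
geometric mesh sequences `t·2^{-k}`; the full filter also runs through mutually incommensurable meshes.  This
file splits the crux EXACTLY along that seam:

* `exists_tendsto_nhdsGT_iff_geometric_and_ratioContinuous` (real analysis) — a net `u` on `(0, ∞)` with
  values in a metric space converges along `𝓝[>] 0` iff (GEO) along every geometric sequence `t / 2^k`,
  `t ∈ [1, 2]`, it converges to a limit NOT depending on `t`, and (CONT) it is asymptotically continuous in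
  the logarithmic scale: for every `ε > 0` there are `δ₀, η > 0` with `dist (u δ) (u δ') < ε` whenever
  `δ, δ' < δ₀` and `|δ'/δ - 1| < η`.  (⇐: write `δₙ = tₙ 2^{-kₙ}`, extract `tₙ → t⋆` by Bolzano–Weierstrass,
  compare `u(δₙ)` with `u(t⋆ 2^{-kₙ})` by (CONT) and use (GEO) at `t⋆`; neither clause alone suffices —
  `u(δ) = sin (2π log₂ δ)` has (CONT) and converges along every geometric sequence, to a `t`-dependent limit.)
* **`limitExists_iff_geometric_and_meshContinuous`** — `LimitExists ↔ (GEO) ∧ (CONT)` for the critical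
  expectations of every (Dobrushin domain, endpoint approximation, bounded continuous observable):
  (GEO) the critical SAW has scaling limits along the geometric meshes `t·2^{-k}` which do not depend on the
  phase `t ∈ [1, 2]`; (CONT) MESH CONTINUITY — critical expectations at two small meshes of ratio close to `1`
  are close.
* `integral_law_dilate` — the exact dilation identity `(rΩ)_δ = r·Ω_{δ/r}` of the tree
  (`LatticeSimilarityOfLimit.map_curve_law_dilate`) read on expectations: the critical expectation of the
  dilated domain `r·Ω` at mesh `δ` is the critical expectation of `Ω` at mesh `δ / r` of the transported
  observable.  Hence (GEO) for `D` along `t·2^{-k}` is a statement about the PURELY DYADIC meshes `2^{-k}` of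
  the shrunken domains `t⁻¹·D`, `t ∈ [1, 2]` (dyadic scaling limits exist and are covariant under all
  dilations), and (CONT) is continuity of the critical SAW laws under dilations of the DOMAIN by factors close
  to `1`, uniformly in the small mesh — a domain-continuity statement.

Everything proved, standard axioms. [folklore]
-/

noncomputable section

open Literature.Probability.RandomPlanarGeometry Literature.Probability.RandomPlanarGeometry.SAW
  Literature.Probability.LatticeModels MeasureTheory Filter Topology Set
open scoped BoundedContinuousFunction

namespace Summit.CriticalPhenomena.SAWScalingLimit.Theorems.SAWRestrictionRigidityLimitExists

open Summit.CriticalPhenomena.SAWScalingLimit.Theses.SAWRestrictionRigidity (LimitExists EventualTight)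

/-! ### Real analysis: full filter = geometric sequences + logarithmic continuity -/

/-- **Convergence along `δ → 0⁺` = convergence along the geometric sequences `t / 2^k` to a phase-independent
limit + asymptotic continuity in the logarithmic scale.**  For a net `u : ℝ → E` into a (pseudo)metric space:
`∃ L, u → L` along `𝓝[>] 0` iff (GEO) `∃ L, ∀ t ∈ [1, 2], u (t / 2^k) → L` as `k → ∞`, and (CONT) for every
`ε > 0` there are `δ₀ > 0`, `η > 0` with `dist (u δ) (u δ') < ε` for all `δ, δ' ∈ (0, δ₀)` with
`|δ'/δ - 1| < η`.  (⇒: restriction to sequences, and the Cauchy property with any `η`.  ⇐: for a sequence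
`δₙ → 0⁺` write `δₙ = tₙ / 2^{kₙ+1}` with `tₙ ∈ (1, 2]` (`exists_nat_pow_near`), extract `t_{φ n} → t⋆ ∈ [1, 2]`
(Bolzano–Weierstrass), compare `u(δ_{φ n})` with `u(t⋆ / 2^{k_{φ n}+1})` through (CONT) — the ratio is
`t⋆ / t_{φ n} → 1` — and conclude with (GEO) at `t⋆`; `Filter.tendsto_of_subseq_tendsto`.) [folklore] -/
theorem exists_tendsto_nhdsGT_iff_geometric_and_ratioContinuous {E : Type*} [PseudoMetricSpace E]
    (u : ℝ → E) :
    (∃ L : E, Tendsto u (𝓝[>] (0 : ℝ)) (𝓝 L)) ↔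
      (∃ L : E, ∀ t ∈ Set.Icc (1 : ℝ) 2, Tendsto (fun k : ℕ => u (t / 2 ^ k)) atTop (𝓝 L)) ∧
      (∀ ε : ℝ, 0 < ε → ∃ δ₀ : ℝ, 0 < δ₀ ∧ ∃ η : ℝ, 0 < η ∧ ∀ δ δ' : ℝ, 0 < δ → δ < δ₀ → 0 < δ' →
        δ' < δ₀ → |δ' / δ - 1| < η → dist (u δ) (u δ') < ε) := by
  constructor
  · rintro ⟨L, hL⟩
    refine ⟨⟨L, fun t ht => hL.comp ?_⟩, fun ε hε => ?_⟩
    · -- `t / 2^k → 0⁺`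
      have h1 : Tendsto (fun k : ℕ => t / (2 : ℝ) ^ k) atTop (𝓝 0) :=
        tendsto_const_nhds.div_atTop (tendsto_pow_atTop_atTop_of_one_lt one_lt_two)
      refine tendsto_nhdsWithin_iff.2 ⟨h1, Eventually.of_forall fun k => ?_⟩
      exact div_pos (lt_of_lt_of_le one_pos ht.1) (pow_pos (two_pos : (0 : ℝ) < 2) k)
    · -- a convergent net is Cauchy; any `η` will do
      have hev : ∀ᶠ x in 𝓝[>] (0 : ℝ), dist (u x) L < ε / 2 :=
        Metric.tendsto_nhds.1 hL _ (half_pos hε)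
      obtain ⟨δ₀, hδ₀, hsub⟩ := mem_nhdsGT_iff_exists_Ioo_subset.1 hev
      refine ⟨δ₀, hδ₀, 1, one_pos, fun δ δ' hδ hδlt hδ' hδ'lt _ => ?_⟩
      have h1 : dist (u δ) L < ε / 2 := hsub ⟨hδ, hδlt⟩
      have h2 : dist (u δ') L < ε / 2 := hsub ⟨hδ', hδ'lt⟩
      calc dist (u δ) (u δ') ≤ dist (u δ) L + dist (u δ') L := dist_triangle_right _ _ _
        _ < ε / 2 + ε / 2 := add_lt_add h1 h2
        _ = ε := add_halves ε
  · rintro ⟨⟨L, hgeo⟩, hmc⟩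
    refine ⟨L, tendsto_of_subseq_tendsto fun ns hns => ?_⟩
    -- (a) a tail of the sequence lies in `(0, 1)`
    obtain ⟨N, hN⟩ := eventually_atTop.1 (hns.eventually (Ioo_mem_nhdsGT one_pos))
    have hδ0 : Tendsto (fun n => ns (n + N)) atTop (𝓝[>] (0 : ℝ)) :=
      hns.comp (tendsto_add_atTop_nat N)
    have hpos : ∀ n, 0 < ns (n + N) := fun n => (hN (n + N) (Nat.le_add_left N n)).1
    -- (b) dyadic decomposition `ns (n + N) = t n / 2 ^ (k n + 1)`, `t n ∈ (1, 2]`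
    have hdec : ∀ n, ∃ k : ℕ, (2 : ℝ) ^ k ≤ (ns (n + N))⁻¹ ∧ (ns (n + N))⁻¹ < 2 ^ (k + 1) := by
      intro n
      obtain ⟨h0, h1⟩ := hN (n + N) (Nat.le_add_left N n)
      exact exists_nat_pow_near ((one_le_inv_iff₀.2 ⟨h0, h1.le⟩)) one_lt_two
    choose k hkle hklt using hdec
    set t : ℕ → ℝ := fun n => ns (n + N) * 2 ^ (k n + 1) with ht_def
    have ht1 : ∀ n, 1 < t n := fun n => by
      calc (1 : ℝ) = ns (n + N) * (ns (n + N))⁻¹ := (mul_inv_cancel₀ (hpos n).ne').symm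
        _ < ns (n + N) * 2 ^ (k n + 1) := mul_lt_mul_of_pos_left (hklt n) (hpos n)
    have ht2 : ∀ n, t n ≤ 2 := fun n => by
      have h : ns (n + N) * 2 ^ k n ≤ ns (n + N) * (ns (n + N))⁻¹ :=
        mul_le_mul_of_nonneg_left (hkle n) (hpos n).le
      rw [mul_inv_cancel₀ (hpos n).ne'] at h
      calc t n = 2 * (ns (n + N) * 2 ^ k n) := by rw [ht_def]; ring
        _ ≤ 2 * 1 := by gcongr
        _ = 2 := mul_one _
    have htmem : ∀ n, t n ∈ Set.Icc (1 : ℝ) 2 := fun n => ⟨(ht1 n).le, ht2 n⟩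
    have hns_eq : ∀ n, ns (n + N) = t n / 2 ^ (k n + 1) := fun n => by
      rw [ht_def]; exact (mul_div_cancel_right₀ _ (pow_ne_zero _ two_ne_zero)).symm
    -- (c) Bolzano–Weierstrass for the phases `t n ∈ [1, 2]`
    obtain ⟨T, hT, φ, hφ, hTφ⟩ := tendsto_subseq_of_bounded (Metric.isBounded_Icc (1 : ℝ) 2) htmem
    rw [closure_Icc] at hT
    have hT0 : (0 : ℝ) < T := by linarith [hT.1]
    -- (d) the exponents `k (φ n) + 1 → ∞`
    have h2k : Tendsto (fun n => (2 : ℝ) ^ (k n + 1)) atTop atTop :=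
      tendsto_atTop_mono (fun n => (hklt n).le) (tendsto_inv_nhdsGT_zero.comp hδ0)
    have hk : Tendsto (fun n => k (φ n) + 1) atTop atTop := by
      have h := h2k.comp hφ.tendsto_atTop
      refine tendsto_atTop_atTop.2 fun K => ?_
      obtain ⟨M, hM⟩ := eventually_atTop.1 (h.eventually_ge_atTop ((2 : ℝ) ^ K))
      exact ⟨M, fun n hn => (pow_le_pow_iff_right₀ (one_lt_two : (1 : ℝ) < 2)).1 (hM n hn)⟩
    -- the comparison meshes `v n = T / 2 ^ (k (φ n) + 1)` on the geometric sequence of phase `T`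
    set v : ℕ → ℝ := fun n => T / 2 ^ (k (φ n) + 1) with hv_def
    have hvpos : ∀ n, 0 < v n := fun n => div_pos hT0 (pow_pos two_pos _)
    have hv0 : Tendsto v atTop (𝓝 0) := by
      have h := (tendsto_inv_atTop_zero.comp (h2k.comp hφ.tendsto_atTop)).const_mul T
      rw [mul_zero] at h
      refine h.congr fun n => ?_
      simp only [hv_def, Function.comp_apply, div_eq_mul_inv]
    have huv : Tendsto (fun n => u (v n)) atTop (𝓝 L) := (hgeo T hT).comp hk
    -- the ratio of the comparison mesh to the original one is `T / t (φ n) → 1`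
    have hratio_eq : ∀ n, v n / ns (φ n + N) = T / t (φ n) := fun n => by
      rw [hns_eq (φ n), hv_def]
      have h2 : (2 : ℝ) ^ (k (φ n) + 1) ≠ 0 := pow_ne_zero _ two_ne_zero
      have htn : t (φ n) ≠ 0 := by linarith [ht1 (φ n)]
      field_simp
    have hratio : Tendsto (fun n => v n / ns (φ n + N)) atTop (𝓝 1) := by
      have h : Tendsto (fun n => T / t (φ n)) atTop (𝓝 (T / T)) := tendsto_const_nhds.div hTφ hT0.ne'
      rw [div_self hT0.ne'] at h
      exact h.congr fun n => (hratio_eq n).symm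
    -- (e) assembly along the subsequence `φ n + N`
    refine ⟨fun n => φ n + N, Metric.tendsto_nhds.2 fun ε hε => ?_⟩
    obtain ⟨δ₀, hδ₀, η, hη, hclose⟩ := hmc (ε / 2) (half_pos hε)
    have hδφ : Tendsto (fun n => ns (φ n + N)) atTop (𝓝[>] (0 : ℝ)) := hδ0.comp hφ.tendsto_atTop
    have e1 : ∀ᶠ n in atTop, ns (φ n + N) ∈ Set.Ioo 0 δ₀ := hδφ.eventually (Ioo_mem_nhdsGT hδ₀)
    have e2 : ∀ᶠ n in atTop, v n < δ₀ := hv0.eventually (Iio_mem_nhds hδ₀)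
    have e3 : ∀ᶠ n in atTop, dist (v n / ns (φ n + N)) 1 < η := Metric.tendsto_nhds.1 hratio η hη
    have e4 : ∀ᶠ n in atTop, dist (u (v n)) L < ε / 2 := Metric.tendsto_nhds.1 huv _ (half_pos hε)
    filter_upwards [e1, e2, e3, e4] with n h1 h2 h3 h4
    have h5 : dist (u (ns (φ n + N))) (u (v n)) < ε / 2 := by
      refine hclose _ _ h1.1 h1.2 (hvpos n) h2 ?_
      rwa [Real.dist_eq] at h3
    calc dist (u (ns (φ n + N))) L ≤ dist (u (ns (φ n + N))) (u (v n)) + dist (u (v n)) L :=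
        dist_triangle _ _ _
      _ < ε / 2 + ε / 2 := add_lt_add h5 h4
      _ = ε := add_halves ε

/-! ### The crux: geometric scaling limits + mesh continuity -/

/-- **`LimitExists` = (GEO) phase-independent scaling limits along the geometric meshes `t·2^{-k}` ∧ (CONT) mesh
continuity.**  The critical `δℤ²` SAW laws have a full scaling limit as a chordal curve family
(stmt-CriticalPhenomena-1371) IF AND ONLY IF, for every Dobrushin domain, endpoint approximation and bounded
continuous observable `f` of the curve class: (GEO) there is ONE real number `L` such that along every geometric
mesh sequence `t / 2^k`, `t ∈ [1, 2]`, the critical expectations `E_{t/2^k}[f(γ)]` converge to `L`; and (CONT)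
for every `ε > 0` there are `δ₀ > 0`, `η > 0` such that `|E_δ[f(γ)] - E_δ'[f(γ)]| < ε` for all meshes
`δ, δ' ∈ (0, δ₀)` with `|δ'/δ - 1| < η`.  (Observable-wise form of the crux +
`exists_tendsto_nhdsGT_iff_geometric_and_ratioContinuous`.)  By `integral_law_dilate`, (GEO) concerns only the
dyadic meshes of the dilated domains `t⁻¹·D`, and (CONT) is continuity of the critical laws under dilations of the
domain close to the identity, uniformly in the small mesh. [folklore] -/
theorem limitExists_iff_geometric_and_meshContinuous : Summit.CriticalPhenomena.SAWScalingLimit.Theses.SAWRestrictionRigidity.LimitExists ↔ ((∀ (D : Literature.Probability.RandomPlanarGeometry.DobrushinDomain) (a b : ℝ → Literature.Probability.LatticeModels.Site 2), Literature.Probability.RandomPlanarGeometry.SAW.IsEndpointApprox D a b → ∀ f : BoundedContinuousFunction (Literature.Probability.RandomPlanarGeometry.CurveClass ℂ) ℝ, ∃ L : ℝ, ∀ t ∈ Set.Icc (1 : ℝ) 2, Filter.Tendsto (fun k : ℕ => ∫ γ, f γ.curve ∂(Literature.Probability.RandomPlanarGeometry.SAW.law D.carrier (t / 2 ^ k) (a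 (t / 2 ^ k)) (b (t / 2 ^ k)))) Filter.atTop (nhds L)) ∧ (∀ (D : Literature.Probability.RandomPlanarGeometry.DobrushinDomain) (a b : ℝ → Literature.Probability.LatticeModels.Site 2), Literature.Probability.RandomPlanarGeometry.SAW.IsEndpointApprox D a b → ∀ (f : BoundedContinuousFunction (Literature.Probability.RandomPlanarGeometry.CurveClass ℂ) ℝ) (ε : ℝ), 0 < ε → ∃ δ₀ : ℝ, 0 < δ₀ ∧ ∃ η : ℝ, 0 < η ∧ ∀ δ δ' : ℝ, 0 < δ → δ < δ₀ → 0 < δ' → δ' < δ₀ → |δ' / δ - 1| < η → |(∫ γ, f γ.curve ∂(Literature.Probability.RandomPlanarGeometry.SAW.law D.carrier δ (a δ) (b δ))) - ∫ γ, f γ.curve ∂(Literature.Probability.RandomPlanarGeometry.SAW.law D.carrier δ' (a δ') (b δ'))| < ε)) := by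
  rw [limitExists_iff_forall_tendsto_integral]
  constructor
  · intro h
    refine ⟨fun D a b hab f => ?_, fun D a b hab f => ?_⟩
    · exact ((exists_tendsto_nhdsGT_iff_geometric_and_ratioContinuous _).1 (h D a b hab f)).1
    · have h2 := ((exists_tendsto_nhdsGT_iff_geometric_and_ratioContinuous
        (fun δ => ∫ γ, f γ.curve ∂(law D.carrier δ (a δ) (b δ)))).1 (h D a b hab f)).2
      simp only [Real.dist_eq] at h2
      exact h2
  · rintro ⟨hgeo, hmc⟩ D a b hab f
    refine (exists_tendsto_nhdsGT_iff_geometric_and_ratioContinuous _).2 ⟨hgeo D a b hab f, ?_⟩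
    simp only [Real.dist_eq]
    exact hmc D a b hab f

/-! ### The dilation identity on expectations -/

/-- **Exact dilation covariance of critical expectations.**  For `r > 0`, a domain `Ω`, a mesh `δ`, lattice
endpoints `a, b` and a bounded continuous observable `g` of the curve class: the critical expectation of `g` for
the SAW of the dilated domain `r·Ω` at mesh `δ` equals the critical expectation, for the SAW of `Ω` at mesh
`δ / r` with the same lattice endpoints, of the transported observable `g ∘ (r·)` — integration of the tree's
mesh-by-mesh identity `map_curve_law_dilate` (`(rΩ)_δ = r·Ω_{δ/r}`).  In particular the critical expectations
of `D` along a geometric mesh sequence `t·2^{-k}` are those of the shrunken domain `t⁻¹·D` along the dyadic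
meshes `2^{-k}`. [folklore] -/
theorem integral_law_dilate {r : ℝ} (hr : 0 < r) (hr' : (r : ℂ) ≠ 0) (Ω : Set ℂ) (δ : ℝ) (a b : Site 2)
    (g : CurveClass ℂ →ᵇ ℝ) :
    ∫ γ, g γ.curve ∂(law ((similarity r hr' 0) '' Ω) δ a b) =
      ∫ γ, g (CurveClass.map (similarity r hr' 0 : C(ℂ, ℂ)) γ.curve) ∂(law Ω (δ / r) a b) := by
  have hmeas := measurable_curveClassMap_similarity (r : ℂ) hr' 0
  calc ∫ γ, g γ.curve ∂(law ((similarity r hr' 0) '' Ω) δ a b)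
        = ∫ x, g x ∂((law ((similarity r hr' 0) '' Ω) δ a b).map (fun γ => γ.curve)) :=
          (integral_map (SAW.aemeasurable_curve _ _ _ _) g.continuous.aestronglyMeasurable).symm
    _ = ∫ x, g x ∂(((law Ω (δ / r) a b).map (fun γ => γ.curve)).map
          (CurveClass.map (similarity r hr' 0 : C(ℂ, ℂ)))) := by
          rw [LatticeSimilarityOfLimit.map_curve_law_dilate hr hr' Ω δ a b]
    _ = ∫ y, g (CurveClass.map (similarity r hr' 0 : C(ℂ, ℂ)) y)
          ∂((law Ω (δ / r) a b).map (fun γ => γ.curve)) :=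
          integral_map hmeas.aemeasurable g.continuous.aestronglyMeasurable
    _ = ∫ γ, g (CurveClass.map (similarity r hr' 0 : C(ℂ, ℂ)) γ.curve) ∂(law Ω (δ / r) a b) :=
          integral_map (SAW.aemeasurable_curve _ _ _ _)
            ((g.continuous.comp (CurveClass.lipschitzWith_map
              (lipschitzWith_similarity (r : ℂ) hr' 0)).continuous).aestronglyMeasurable)

/-- The lattice similarity `z ↦ t z` undoes `z ↦ t⁻¹ z`. [folklore] -/
theorem similarity_comp_similarity_inv {t : ℝ} (ht' : (t : ℂ) ≠ 0) (hti : ((t⁻¹ : ℝ) : ℂ) ≠ 0) :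
    (similarity t ht' 0 : C(ℂ, ℂ)).comp (similarity (t⁻¹ : ℝ) hti 0 : C(ℂ, ℂ)) = ContinuousMap.id ℂ := by
  ext z
  change similarity t ht' 0 (similarity (t⁻¹ : ℝ) hti 0 z) = z
  rw [similarity_apply, similarity_apply, add_zero, add_zero, ← mul_assoc, Complex.ofReal_inv,
    mul_inv_cancel₀ ht', one_mul]

/-- **Geometric meshes of `Ω` = dyadic meshes of the shrunken domains.**  For `t > 0`, the critical expectation
of `f` for the SAW of `Ω` at the geometric mesh `t / 2^k` (lattice endpoints `a, b`) equals the critical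
expectation of the transported observable `f ∘ (t·)` for the SAW of the shrunken domain `t⁻¹·Ω` at the DYADIC
mesh `1 / 2^k` with the same lattice endpoints (`integral_law_dilate` with `r = t⁻¹`, and `(t·) ∘ (t⁻¹·) = id`
on curve classes).  So clause (GEO) of `limitExists_iff_geometric_and_meshContinuous` for a domain `D` quantifies,
phase by phase `t ∈ [1, 2]`, over the purely dyadic critical expectations of the dilated domains `t⁻¹·D`.
[folklore] -/
theorem integral_law_geometric_eq_dyadic {t : ℝ} (ht : 0 < t) (ht' : (t : ℂ) ≠ 0)
    (hti : ((t⁻¹ : ℝ) : ℂ) ≠ 0) (Ω : Set ℂ) (k : ℕ) (a b : Site 2) (f : CurveClass ℂ →ᵇ ℝ) :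
    ∫ γ, f γ.curve ∂(law Ω (t / 2 ^ k) a b) =
      ∫ γ, f (CurveClass.map (similarity t ht' 0 : C(ℂ, ℂ)) γ.curve)
        ∂(law ((similarity (t⁻¹ : ℝ) hti 0) '' Ω) (1 / 2 ^ k) a b) := by
  -- the transported observable `g = f ∘ (t·)` as a bounded continuous function
  set g : CurveClass ℂ →ᵇ ℝ := f.compContinuous
    ⟨CurveClass.map (similarity t ht' 0 : C(ℂ, ℂ)),
      (CurveClass.lipschitzWith_map (lipschitzWith_similarity (t : ℂ) ht' 0)).continuous⟩ with hg
  have hdil := integral_law_dilate (inv_pos.2 ht) hti Ω (1 / 2 ^ k) a b g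
  have hmesh : (1 : ℝ) / 2 ^ k / t⁻¹ = t / 2 ^ k := by
    rw [div_inv_eq_mul, one_div, mul_comm, ← div_eq_mul_inv]
  rw [hmesh] at hdil
  -- `g ∘ (t⁻¹·) = f`
  have hgf : ∀ c : CurveClass ℂ, g (CurveClass.map (similarity (t⁻¹ : ℝ) hti 0 : C(ℂ, ℂ)) c) = f c := by
    intro c
    rw [hg, BoundedContinuousFunction.compContinuous_apply, ContinuousMap.coe_mk, CurveClass.map_map,
      similarity_comp_similarity_inv ht' hti, CurveClass.map_id]
  simp only [hgf] at hdil
  rw [← hdil, hg]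
  rfl

end Summit.CriticalPhenomena.SAWScalingLimit.Theorems.SAWRestrictionRigidityLimitExists

end
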